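import Summits.ResolutionOfSingularities.ResolutionOfSingularities.Theorems.DecompositionDescentLU3
import HarnessLib

/-!
# DecompositionDescentLU (4/7) — THE WITNESS LAW: `DecWitnessLUAbove k O → RelLocalUniformization k K O`, hypothesis-free

Part 4 of the g27 node `DecompositionDescentLU` of the ROOT/RESIDUAL decomposition cell `decomp-res`
(lens 1, window (W-dec) of critic rows 178/193/202); see the module docstring of
`Summits.ResolutionOfSingularities.ResolutionOfSingularities.Theorems.DecompositionDescentLU` (part 1/7)
for the thesis, the three layers of [CossartPiltant2008, Prop. 9.3], the two currencies of the decomposition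
cell (structure: `DecompositionFieldLUAbove`; witnesses: `DecWitnessLUAbove`), the laws, the residual R27, the
cut and the sources.  Problem side, sorry-free, hypothesis-free.

This part: `relLU_of_decWitnessLUAbove` (kernel; engine = part 3, layer-1 engine = parts 1–2).
-/

noncomputable section

open IsLocalRing IntermediateField Polynomial Literature.AlgebraicGeometry.Resolution
open scoped Pointwise

namespace Summit.ResolutionOfSingularities.ResolutionOfSingularities.Theorems.DecompositionDescentLU

universe u

section Law3

variable {k K : Type} [Field k] [Field K] [Algebra k K]

/-! ### E5. The witness law -/

set_option maxHeartbeats 1600000 in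
/-- **THE WITNESS LAW OF DECOMPOSITION DESCENT (kernel, HYPOTHESIS-FREE): `DecWitnessLUAbove k O →
RelLocalUniformization k K O`.**  Given a model `R ⊆ O`: enlarge it by the Galois-approximation coefficients
`c ⊆ K ∩ O` of the Galois closure of the top `K′` (`exists_finset_regular_below_of_witnesses`); the cell gives
`t`, witnesses `x′ ⊆ K′ ∩ K^h` standard-étale over `R[c][t]` and `R[c][t][x′]` regular at the centre; the
NORMALIZATION SANDWICH (`exists_normalization_regular_of_witnesses`: F1 = finiteness of normalization is the
tree's `exists_adjoin_isIntegrallyClosedIn`; a regular local ring is normal) identifies that local ring with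
the local ring of the integral closure `k[t₁ ∪ t₁′]` of the normal model `k[t₁] ⊇ R[c][t]` in `K(x′) ⊆ Z`;
the engine (F3 = étale descent of regularity through the decomposition layer, the tree's (44)(45), plus
`dim R₁ = dim R₁′`) brings regularity DOWN to `k[t₁]`; pull back to `K` and transport.  No fact binder:
F1, F3 discharged; F2′, ZMT unused. (Sources: CossartPiltant2008, Prop. 9.3 (HAL pp. 26–28).) -/
theorem relLU_of_decWitnessLUAbove {O : ValuationSubring K} (h : DecWitnessLUAbove k O) :
    RelLocalUniformization k K O := by
  classical
  intro R hRfg hRfrac hRO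
  obtain ⟨OE, hOE, K', hK'fd, hK'sep, hLU⟩ := h
  haveI := hRfrac
  haveI := hK'fd
  haveI := hK'sep
  let L := AlgebraicClosure K
  let ι : K →+* L := algebraMap K L
  have hιinj : Function.Injective ι := (algebraMap K L).injective
  let φ : K →ₐ[k] L := IsScalarTower.toAlgHom k K L
  have hφ : ∀ x : K, φ x = ι x := fun _ => rfl
  -- (1) membership in `O` and `v < 1` are read upstairs (`O = O_E ∩ K`)
  have hmemO : ∀ x : K, x ∈ O ↔ ι x ∈ OE := fun x => by
    rw [← hOE]; rfl
  have hvalO : ∀ y : K, O.valuation y < 1 ↔ OE.valuation (ι y) < 1 := fun y => by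
    rw [← valuation_comap_lt_one_iff OE ι y, hOE]
  -- (2) the subfield `M = K` of `L = K̄`; `L | M` normal
  let M : Subfield L := ι.fieldRange
  have hMmem : ∀ y : L, y ∈ M ↔ ∃ x : K, ι x = y := fun y => RingHom.mem_fieldRange
  have hιM : ∀ x : K, ι x ∈ M := fun x => (hMmem _).mpr ⟨x, rfl⟩
  have hkM : ∀ c : k, algebraMap k L c ∈ M := fun c => by
    rw [IsScalarTower.algebraMap_apply k K L]; exact hιM _
  have hkO : ∀ c : k, algebraMap k L c ∈ OE := fun c => by
    rw [IsScalarTower.algebraMap_apply k K L, ← hmemO]; exact hRO (R.algebraMap_mem c)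
  haveI : Algebra.IsAlgebraic M L := by
    refine ⟨fun y => ?_⟩
    obtain ⟨p, hp0, hpy⟩ := (Algebra.IsAlgebraic.isAlgebraic (R := K) y)
    let e : K ≃+* M := ι.rangeRestrictFieldEquiv
    refine ⟨p.map (e : K →+* M), fun h0 => hp0 ?_, ?_⟩
    · exact (Polynomial.map_eq_zero_iff (e : K →+* M).injective).mp
        (by rw [h0])
    · rw [Polynomial.aeval_def, Polynomial.eval₂_map]
      have : (algebraMap M L).comp (e : K →+* M) = ι := by
        ext x; rfl
      rw [this]
      exact hpy
  haveI : IsAlgClosure M L := ⟨inferInstance, inferInstance⟩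
  haveI : Normal M L := IsAlgClosure.normal M L
  -- (3) generators of the top `K′` over `K`, read in `L`: integral and separable over `M`; `K′ ⊆ M(gen)`
  obtain ⟨S, hS⟩ := Module.finite_def.mp hK'fd
  let gen : Finset L := S.image (fun y : K' => (y : L))
  have hgen : ∀ z ∈ gen, IsIntegral M z ∧ IsSeparable M z := by
    intro z hz
    obtain ⟨y, -, rfl⟩ := Finset.mem_image.mp hz
    have hpy : Polynomial.aeval (y : L) (minpoly K y) = 0 := by
      change Polynomial.aeval (algebraMap K' L y) (minpoly K y) = 0
      rw [Polynomial.aeval_algebraMap_apply, minpoly.aeval, map_zero]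
    have hp0 : minpoly K y ≠ 0 := minpoly.ne_zero (IsIntegral.of_finite K y)
    have hpsep : (minpoly K y).Separable := Algebra.IsSeparable.isSeparable K y
    have hfM : ∀ i, ((minpoly K y).map ι).coeff i ∈ M := fun i => by
      rw [Polynomial.coeff_map]; exact hιM _
    obtain ⟨f₀, hf₀⟩ := exists_map_eq_of_coeff_mem hfM
    have hf₀z : Polynomial.aeval (y : L) f₀ = 0 := by
      rw [Polynomial.aeval_def, ← Polynomial.eval_map, hf₀, Polynomial.eval_map, ← Polynomial.aeval_def]
      exact hpy
    have hf₀ne : f₀ ≠ 0 := by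
      intro h0
      apply hp0
      have h1 : (minpoly K y).map ι = 0 := by rw [← hf₀, h0, Polynomial.map_zero]
      exact (Polynomial.map_eq_zero_iff hιinj).mp h1
    have hint : IsIntegral M (y : L) := isAlgebraic_iff_isIntegral.mp ⟨f₀, hf₀ne, hf₀z⟩
    have hf₀sep : f₀.Separable := by
      rw [← Polynomial.separable_map (algebraMap M L), hf₀]; exact hpsep.map
    exact ⟨hint, hf₀sep.of_dvd (minpoly.dvd M (y : L) hf₀z)⟩
  have hK'gen : (K' : Set L) ⊆ (IntermediateField.adjoin M (gen : Set L) : Set L) := by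
    intro z hz
    let W : Submodule K K' :=
      { carrier := {w | (w : L) ∈ IntermediateField.adjoin M (gen : Set L)}
        add_mem' := fun {a b} ha hb => by
          simp only [Set.mem_setOf_eq] at ha hb ⊢
          rw [IntermediateField.coe_add]
          exact add_mem ha hb
        zero_mem' := by
          simp only [Set.mem_setOf_eq]
          exact zero_mem _
        smul_mem' := fun a w hw => by
          simp only [Set.mem_setOf_eq] at hw ⊢
          rw [IntermediateField.coe_smul, Algebra.smul_def]
          exact mul_mem ((IntermediateField.adjoin M (gen : Set L)).algebraMap_mem ⟨ι a, hιM a⟩) hw }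
    have hSW : (S : Set K') ⊆ (W : Set K') := fun w hw =>
      IntermediateField.subset_adjoin M _ (Finset.mem_image_of_mem _ (Finset.mem_coe.mp hw))
    have htop : (⊤ : Submodule K K') ≤ W := by
      rw [← hS]; exact Submodule.span_le.mpr hSW
    exact htop (Submodule.mem_top : (⟨z, hz⟩ : K') ∈ (⊤ : Submodule K K'))
  -- (4) the engine's Galois-approximation coefficients `c ⊆ K ∩ O`, pulled back to `K`
  obtain ⟨c, hcM, hcO, hreg⟩ := exists_finset_regular_below_of_witnesses OE k hkM gen hgen
  have hc_sub : (c : Set L) ⊆ Set.range ι := fun z hz => (hMmem z).mp (hcM hz)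
  let cK : Finset K := c.preimage ι hιinj.injOn
  have hιcK : ι '' (cK : Set K) = (c : Set L) := by
    rw [Finset.coe_preimage]; exact Set.image_preimage_eq_of_subset hc_sub
  -- (5) the enlarged model `R₂ = R[c] ⊆ O`
  obtain ⟨s₀, hs₀⟩ := hRfg
  let R₂ : Subalgebra k K := Algebra.adjoin k ((s₀ : Set K) ∪ (cK : Set K))
  have hRR₂ : R ≤ R₂ := by
    rw [← hs₀]; exact Algebra.adjoin_mono Set.subset_union_left
  have hR₂fg : R₂.FG := ⟨s₀ ∪ cK, by rw [Finset.coe_union]⟩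
  haveI : IsFractionRing R₂ K := isFractionRing_of_le hRR₂
  have hR₂O : R₂.toSubring ≤ O.toSubring := by
    change R₂ ≤ ({ O.toSubring with algebraMap_mem' := fun c => hRO (R.algebraMap_mem c) } : Subalgebra k K)
    refine Algebra.adjoin_le ?_
    rintro x (hx | hx)
    · rw [← hs₀] at hRO
      exact hRO (Algebra.subset_adjoin hx)
    · rw [Finset.mem_coe, Finset.mem_preimage] at hx
      exact (hmemO x).mpr (hcO _ hx)
  -- (6) the cell's clause for `R₂`: enlargement `t`, witnesses `x′`, `R₂[t][x′]` regular at the centre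
  obtain ⟨t, htO, x', hx'K', hwit, hregT⟩ := hLU R₂ hR₂fg inferInstance hR₂O
  -- (7) the generators `s = ι(s₀ ∪ c ∪ t)` of `R₂[t]` read in `L`
  let sK : Finset K := s₀ ∪ cK ∪ t
  let s : Finset L := sK.image ι
  have hsKO : ∀ x ∈ sK, x ∈ O := by
    intro x hx
    rcases Finset.mem_union.mp hx with hx | hx
    · rcases Finset.mem_union.mp hx with hx | hx
      · rw [← hs₀] at hRO
        exact hRO (Algebra.subset_adjoin hx)
      · rw [Finset.mem_preimage] at hx
        exact (hmemO x).mpr (hcO _ hx)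
    · exact htO x hx
  have hsM : (s : Set L) ⊆ M := by
    intro z hz
    rw [Finset.coe_image] at hz
    obtain ⟨x, -, rfl⟩ := hz
    exact hιM x
  have hsO : ∀ z ∈ s, z ∈ OE := by
    intro z hz
    obtain ⟨x, hx, rfl⟩ := Finset.mem_image.mp hz
    exact (hmemO x).mp (hsKO x hx)
  have hR₂t : Algebra.adjoin k ((R₂ : Set K) ∪ (t : Set K)) = Algebra.adjoin k (sK : Set K) := by
    apply le_antisymm
    · refine Algebra.adjoin_le (Set.union_subset (fun x hx => ?_) (fun x hx => ?_))
      · refine (Algebra.adjoin_mono ?_) hx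
        intro y hy
        simp only [sK, Finset.coe_union]
        exact Or.inl hy
      · apply Algebra.subset_adjoin
        simp only [sK, Finset.coe_union]
        exact Or.inr hx
    · refine Algebra.adjoin_le ?_
      intro x hx
      simp only [sK, Finset.coe_union] at hx
      rcases hx with hx | hx
      · exact Algebra.subset_adjoin (Or.inl (Algebra.subset_adjoin hx))
      · exact Algebra.subset_adjoin (Or.inr hx)
  have hmapS : (Algebra.adjoin k (sK : Set K)).map φ = Algebra.adjoin k (s : Set L) := by
    rw [AlgHom.map_adjoin]
    simp only [s, Finset.coe_image]
    rfl
  have hmemS : ∀ x : K, x ∈ Algebra.adjoin k (sK : Set K) → ι x ∈ Algebra.adjoin k (s : Set L) :=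
    fun x hx => by
      rw [← hmapS]; exact Subalgebra.mem_map.mpr ⟨x, hx, rfl⟩
  have hR₂s : R₂.map φ ≤ Algebra.adjoin k (s : Set L) := by
    intro z hz
    obtain ⟨x, hx, rfl⟩ := Subalgebra.mem_map.mp hz
    exact hmemS x (by rw [← hR₂t]; exact Algebra.subset_adjoin (Or.inl hx))
  have hadj_cl : (Algebra.adjoin k (s : Set L) : Set L) ⊆
      (Subfield.closure (Set.range (algebraMap k L) ∪ (s : Set L)) : Set L) := by
    intro z hz
    rw [SetLike.mem_coe, ← Subalgebra.mem_toSubring, Algebra.adjoin_eq_ring_closure] at hz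
    exact Subring.closure_le.mpr (fun w hw => Subfield.subset_closure hw) hz
  have hMs : M ≤ Subfield.closure (Set.range (algebraMap k L) ∪ (s : Set L)) := by
    intro y hy
    obtain ⟨x, rfl⟩ := (hMmem y).mp hy
    obtain ⟨a, b, -, hab⟩ := IsFractionRing.div_surjective (A := R₂) x
    rw [← hab, map_div₀]
    refine div_mem (hadj_cl (hR₂s ?_)) (hadj_cl (hR₂s ?_))
    · exact Subalgebra.mem_map.mpr ⟨a, a.2, rfl⟩
    · exact Subalgebra.mem_map.mpr ⟨b, b.2, rfl⟩
  -- the upstairs model of the cell is `k[s ∪ x′]`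
  have hTeq : Algebra.adjoin k (ι '' ((R₂ : Set K) ∪ (t : Set K)) ∪ (x' : Set L)) =
      Algebra.adjoin k ((s : Set L) ∪ (x' : Set L)) := by
    apply le_antisymm
    · refine Algebra.adjoin_le (Set.union_subset ?_ (fun z hz => Algebra.subset_adjoin (Or.inr hz)))
      rintro _ ⟨x, hx, rfl⟩
      refine (Algebra.adjoin_mono Set.subset_union_left) (hmemS x ?_)
      rw [← hR₂t]; exact Algebra.subset_adjoin hx
    · refine Algebra.adjoin_le (Set.union_subset ?_ (fun z hz => Algebra.subset_adjoin (Or.inr hz)))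
      intro z hz
      obtain ⟨x, hx, rfl⟩ := Finset.mem_image.mp hz
      refine Algebra.subset_adjoin (Or.inl ⟨x, ?_, rfl⟩)
      rcases Finset.mem_union.mp hx with hx | hx
      · refine Or.inl ?_
        change x ∈ R₂
        refine Algebra.subset_adjoin ?_
        rcases Finset.mem_union.mp hx with hx | hx
        · exact Or.inl hx
        · exact Or.inr hx
      · exact Or.inr hx
  have hregT' : IsRegularLocalRing
      (locAtCentre (Algebra.adjoin k ((s : Set L) ∪ (x' : Set L))).toSubring OE) := by
    rw [← hTeq]; exact hregT
  -- witness data read in `L`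
  have hRtO : Algebra.adjoin k ((R₂ : Set K) ∪ (t : Set K)) ≤
      ({ O.toSubring with algebraMap_mem' := fun c => hRO (R.algebraMap_mem c) } : Subalgebra k K) :=
    Algebra.adjoin_le (Set.union_subset (fun x hx => hR₂O hx) (fun x hx => htO x hx))
  have hsdata : ∀ x ∈ x', x ∈ OE ∧ (∃ x₀ ∈ M, OE.valuation (x - x₀) < 1) ∧
      ∃ f : L[X], (∀ i, f.coeff i ∈ M) ∧ (∀ i, f.coeff i ∈ OE) ∧ f.eval x = 0 ∧
        OE.valuation ((derivative f).eval x) = 1 := by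
    intro x hx
    obtain ⟨hxO, ⟨y, hy⟩, g, -, hgR, hgx, hgder⟩ := hwit x hx
    refine ⟨hxO, ⟨ι y, hιM y, hy⟩, g.map ι, fun i => ?_, fun i => ?_, ?_, ?_⟩
    · rw [Polynomial.coeff_map]; exact hιM _
    · rw [Polynomial.coeff_map, ← hmemO]; exact hRtO (hgR i)
    · rw [Polynomial.eval_map, ← Polynomial.aeval_def]; exact hgx
    · rw [Polynomial.derivative_map, Polynomial.eval_map, ← Polynomial.aeval_def]; exact hgder
  have hx'O : ∀ x ∈ x', x ∈ OE := fun x hx => (hsdata x hx).1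
  have hx'int : ∀ x ∈ x', IsIntegral M x := fun x hx => by
    obtain ⟨-, -, f, hfM, -, hfx, hder⟩ := hsdata x hx
    exact isIntegral_of_henselRoot OE hfM hfx hder
  have hx'sep : ∀ x ∈ x', IsSeparable M x := fun x hx => by
    obtain ⟨-, -, f, hfM, -, hfx, hder⟩ := hsdata x hx
    exact isSeparable_of_henselRoot OE hfM hfx hder
  have hx'intS : ∀ x ∈ x', IsIntegral (Algebra.adjoin k (s : Set L)) x := by
    intro x hx
    obtain ⟨-, -, g, hgm, hgR, hgx, -⟩ := hwit x hx
    have hlift : g.map ι ∈ Polynomial.lifts (algebraMap (Algebra.adjoin k (s : Set L)) L) := by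
      rw [Polynomial.lifts_iff_coeff_lifts]
      intro n
      rw [Polynomial.coeff_map]
      refine ⟨⟨ι (g.coeff n), hmemS _ (by rw [← hR₂t]; exact hgR n)⟩, rfl⟩
    obtain ⟨q, hq, -, hqm⟩ := Polynomial.lifts_and_degree_eq_and_monic hlift (hgm.map ι)
    refine ⟨q, hqm, ?_⟩
    rw [← Polynomial.eval_map, hq, Polynomial.eval_map, ← Polynomial.aeval_def]
    exact hgx
  -- (8) the normalization sandwich: normal `k[t₁] ⊇ k[s]`, integral closure `k[t₁ ∪ t₁′]` in `M(x′)`, regular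
  obtain ⟨t₁, ht₁M, hst₁, ht₁O, hnorm, t₁', ht₁'K', hext, hO', hreg'⟩ :=
    exists_normalization_regular_of_witnesses OE k hkM hkO s hsM hsO hMs x' hx'O hx'int hx'sep hx'intS hregT'
  -- (9) the engine: `k[t₁]` is regular at the centre of `O_E`
  let K'' : Subfield L := (IntermediateField.adjoin M (x' : Set L)).toSubfield
  have hMK'' : M ≤ K'' := fun y hy => (IntermediateField.adjoin M (x' : Set L)).algebraMap_mem ⟨y, hy⟩
  have hrange : Set.range (algebraMap M L) = (M : Set L) := by
    ext z; constructor
    · rintro ⟨w, rfl⟩; exact w.2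
    · intro hz; exact ⟨⟨z, hz⟩, rfl⟩
  have hK''cl : K'' ≤ Subfield.closure ((M : Set L) ∪ (x' : Set L)) := by
    intro y hy
    change y ∈ (IntermediateField.adjoin M (x' : Set L)).toSubfield at hy
    rw [IntermediateField.adjoin_toSubfield, hrange] at hy
    exact hy
  have hx'gen : (x' : Set L) ⊆ (IntermediateField.adjoin M (gen : Set L) : Set L) :=
    fun z hz => hK'gen (hx'K' hz)
  have hMcl : M ≤ Subfield.closure (Set.range (algebraMap k L) ∪ (t₁ : Set L)) :=
    hMs.trans (Subfield.closure_mono (Set.union_subset_union_right _ hst₁))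
  have hnorm' : ∀ y : L, y ∈ M → IsIntegral (Algebra.adjoin k (t₁ : Set L)) y →
      y ∈ Algebra.adjoin k (t₁ : Set L) := fun y hy hint => hnorm y hy hint
  have hct₁ : (c : Set L) ⊆ Algebra.adjoin k (t₁ : Set L) := by
    rw [← hιcK]
    rintro _ ⟨x, hx, rfl⟩
    refine Algebra.subset_adjoin (hst₁ (Finset.mem_image_of_mem ι ?_))
    simp only [sK, Finset.mem_union]
    exact Or.inl (Or.inr hx)
  have hext' : ∀ y : L, y ∈ K'' → (IsIntegral (Algebra.adjoin k (t₁ : Set L)) y ↔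
      y ∈ Algebra.adjoin k ((t₁ : Set L) ∪ (t₁' : Set L))) := fun y hy => hext y hy
  have hregT := hreg x' hx'gen hsdata K'' hMK'' hK''cl t₁ ht₁M hMcl ht₁O hnorm' hct₁ t₁' ht₁'K' hext'
    hO' hreg'
  -- (10) pull the model back to `K`
  have ht₁K : (t₁ : Set L) ⊆ Set.range ι := fun z hz => (hMmem z).mp (ht₁M hz)
  let tK : Finset K := t₁.preimage ι hιinj.injOn
  have hιtK : ι '' (tK : Set K) = (t₁ : Set L) := by
    rw [Finset.coe_preimage]; exact Set.image_preimage_eq_of_subset ht₁K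
  let A₀ : Subalgebra k K := Algebra.adjoin k (tK : Set K)
  have hA₀map : A₀.map φ = Algebra.adjoin k (t₁ : Set L) := by
    rw [AlgHom.map_adjoin, ← hιtK]; rfl
  have hmemA₀ : ∀ x : K, x ∈ A₀ ↔ ι x ∈ Algebra.adjoin k (t₁ : Set L) := fun x => by
    rw [← hA₀map, Subalgebra.mem_map]
    constructor
    · exact fun hx => ⟨x, hx, rfl⟩
    · rintro ⟨y, hy, hyx⟩
      rwa [← hιinj hyx]
  have hR₂t₁ : R₂.map φ ≤ Algebra.adjoin k (t₁ : Set L) :=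
    hR₂s.trans (Algebra.adjoin_mono hst₁)
  have hRA₀ : R ≤ A₀ := fun x hx =>
    (hmemA₀ x).mpr (hR₂t₁ (Subalgebra.mem_map.mpr ⟨x, hRR₂ hx, rfl⟩))
  have hA₀fg : A₀.FG := ⟨tK, rfl⟩
  have hA₀O : A₀.toSubring ≤ O.toSubring := fun x hx => (hmemO x).mpr (ht₁O ((hmemA₀ x).mp hx))
  refine ⟨A₀, hA₀O, hRA₀, hA₀fg, ?_⟩
  -- (11) transport of the local ring at the centre along `K ↪ K̄`
  have hT : A₀.toSubring.map ι = (Algebra.adjoin k (t₁ : Set L)).toSubring := by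
    ext y
    rw [Subring.mem_map]
    constructor
    · rintro ⟨x, hx, rfl⟩
      exact (hmemA₀ x).mp hx
    · intro hy
      have hy' : y ∈ A₀.map φ := by rw [hA₀map]; exact hy
      obtain ⟨x, hx, rfl⟩ := Subalgebra.mem_map.mp hy'
      exact ⟨x, hx, rfl⟩
  let g : A₀.toSubring ≃+* (Algebra.adjoin k (t₁ : Set L)).toSubring :=
    (A₀.toSubring.equivMapOfInjective ι hιinj).trans (RingEquiv.subringCongr hT)
  have hg : ∀ x : A₀.toSubring, ((g x : (Algebra.adjoin k (t₁ : Set L)).toSubring) : L) = ι x :=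
    fun _ => rfl
  set P : Ideal A₀.toSubring := Ideal.comap (Subring.inclusion hA₀O) (IsLocalRing.maximalIdeal O) with hP
  set P' : Ideal (Algebra.adjoin k (t₁ : Set L)).toSubring :=
    Ideal.comap (Subring.inclusion ht₁O) (IsLocalRing.maximalIdeal OE) with hP'
  haveI : P'.IsPrime := Ideal.IsPrime.comap _
  haveI : P.IsPrime := Ideal.IsPrime.comap _
  haveI hregP' : IsRegularLocalRing (Localization.AtPrime P') := hregT
  have hPP' : P = P'.comap g.toRingHom := by
    ext x
    simp only [hP, hP', Ideal.mem_comap, RingEquiv.toRingHom_eq_coe, RingHom.coe_coe]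
    rw [ValuationSubring.valuation_lt_one_iff, ValuationSubring.valuation_lt_one_iff]
    change O.valuation (x : K) < 1 ↔ OE.valuation ((g x : (Algebra.adjoin k (t₁ : Set L)).toSubring) : L) < 1
    rw [hg]
    exact hvalO x
  have hmap : Submonoid.map g.toRingHom.toMonoidHom P.primeCompl = P'.primeCompl := by
    ext y
    constructor
    · rintro ⟨x, hx, rfl⟩
      change g x ∉ P'
      have hx' : x ∉ P := hx
      rw [hPP', Ideal.mem_comap] at hx'
      exact hx'
    · intro hy
      have hy' : y ∉ P' := hy
      refine ⟨g.symm y, ?_, ?_⟩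
      · change g.symm y ∉ P
        rw [hPP', Ideal.mem_comap]
        change ¬ g (g.symm y) ∈ P'
        rw [g.apply_symm_apply]
        exact hy'
      · change g (g.symm y) = y
        exact g.apply_symm_apply y
  exact IsRegularLocalRing.of_ringEquiv (R := Localization.AtPrime P')
    (IsLocalization.ringEquivOfRingEquiv (Localization.AtPrime P) (Localization.AtPrime P') g hmap).symm

end Law3

end Summit.ResolutionOfSingularities.ResolutionOfSingularities.Theorems.DecompositionDescentLU

end
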